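import Mathlib.Algebra.MvPolynomial.PDeriv
import Mathlib.Algebra.MvPolynomial.Division
import Mathlib.RingTheory.MvPolynomial.Homogeneous
import Mathlib.RingTheory.MvPolynomial.EulerIdentity
import Mathlib.FieldTheory.Perfect
import Mathlib.Algebra.CharP.Lemmas
import HarnessLib

/-!
# Steer σ-residual — §σ2.26 (B3) CORE: in characteristic 2 a form of even degree whose partial derivatives omit the centre
# variable is a BINARY form modulo squares (`F_d = A_d(U, V) + H²`), with Euler factor `∂_U A = V·G`, `∂_V A = U·G`

OURS (campaign res-hironaka, rung L ★L-G4, slot W4.1, crux `Steer` stmt-ResolutionOfSingularities-16345; res-L0-w41-plan-1 RULING 75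
«res-type-026 (B3) CORE = GO, FILE IT» on RULING 66d; source res-L0-w41-strat-2 STRAT2-MEMO-1 rev 12 §6⁗ (B3) «NORMAL FORM IN THE CONSTANT
REGIME … `F_d ≡ A_d(U, V)` mod squares, a BINARY form, and the centre is the `W`-point; Euler in char 2 gives `∂_U A_d = V·G`,
`∂_V A_d = U·G`»; consumers: strat-2 §σ2.26 `NoEternalConstOrderIsolatedChain` docstring, idea-1 g7 / idea-3 g4 sketches). Theses-free,
definition-free, elementary algebra of multivariate polynomials; AI-produced, weaker than expert review; nothing here is a statement of
the manuscript under review.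

* `exists_pow_eq_of_forall_dvd` — over a perfect ring of characteristic `p`, a polynomial all of whose exponents are divisible by `p`
  is a `p`-th power `q ^ p`, with `supp q = (1/p)·supp` (adapted from the tree's private FSV18 lemma);
* `forall_dvd_of_forall_pderiv_eq_zero` — vanishing of all partial derivatives ⇒ all exponents divisible by `p`;
* **`exists_add_sq_of_forall_pderiv_free`** — (B3) CORE: `κ` perfect of characteristic `2`, `F` homogeneous of EVEN degree `d`, every
  `∂_i F` free of the variable `w` ⇒ `F = A + H ^ 2` with `A` free of `w` and homogeneous of degree `d`, `H` homogeneous of degree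
  `d / 2` (any index type; `w` = the centre variable);
* `sum_X_mul_pderiv_eq_zero`, `X_mul_pderiv_eq_of_free`, **`exists_euler_factor`** — Euler in characteristic `2` for even degree:
  `∑ Xᵢ ∂ᵢ A = 0`; for three variables and `A` free of `X 2`: `X 0 · ∂₀ A = X 1 · ∂₁ A`, hence `∂₀ A = X 1 · G`, `∂₁ A = X 0 · G`.
NOT typed here (strat-2's geometric half, run vocabulary): «the initial form `(D F_m)_δ` has a point of multiplicity `δ` at the next
centre ⇒ its partials lie in `κ[U, V]`» and the non-rational-centre case `(DF)_δ = c_D · L^δ`.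
-/

noncomputable section

-- single-problem summit: the doubled namespace component `ResolutionOfSingularities` is forced
set_option linter.dupNamespace false

namespace Summit.ResolutionOfSingularities.ResolutionOfSingularities.Theorems.SwitchingDichotomy.ConstOrder

open MvPolynomial Finset

/-- Over a perfect ring of prime characteristic `p`: a polynomial all of whose exponents are divisible by `p` is a `p`-th power
(take `p`-th roots of the coefficients and divide the exponents by `p`). [folklore]
-- adapted from the private `exists_pow_eq_of_forall_pderiv_eq_zero` of Literature/Computability/AlgebraicComplexity/FSV18Lemma53Reduction.lean -/
theorem exists_pow_eq_of_forall_dvd {L σ : Type*} [Field L] (p : ℕ) [Fact p.Prime] [CharP L p] [PerfectRing L p]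
    {h : MvPolynomial σ L} (hdiv : ∀ m ∈ h.support, ∀ i, p ∣ m i) :
    ∃ q : MvPolynomial σ L, q ^ p = h ∧ ∀ n ∈ q.support, p • n ∈ h.support := by
  classical
  refine ⟨∑ m ∈ h.support, monomial (m.mapRange (· / p) (Nat.zero_div p))
      ((frobeniusEquiv L p).symm (coeff m h)), ?_, ?_⟩
  · rw [sum_pow_char p]
    conv_rhs => rw [← support_sum_monomial_coeff h]
    refine Finset.sum_congr rfl fun m hm => ?_
    rw [monomial_pow]
    have h1 : p • (m.mapRange (· / p) (Nat.zero_div p) : σ →₀ ℕ) = m := by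
      ext i
      rw [Finsupp.smul_apply, Finsupp.mapRange_apply, smul_eq_mul]
      exact Nat.mul_div_cancel' (hdiv m hm i)
    have h2 : ((frobeniusEquiv L p).symm (coeff m h)) ^ p = coeff m h := by
      rw [← frobeniusEquiv_def, RingEquiv.apply_symm_apply]
    rw [h1, h2]
  · intro n hn
    obtain ⟨m, hm, hmn⟩ : ∃ m ∈ h.support, m.mapRange (· / p) (Nat.zero_div p) = n := by
      by_contra hcon
      push Not at hcon
      apply MvPolynomial.mem_support_iff.mp hn
      rw [coeff_sum]
      refine Finset.sum_eq_zero fun m hm => ?_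
      rw [coeff_monomial, if_neg (hcon m hm)]
    have h1 : p • n = m := by
      rw [← hmn]
      ext i
      rw [Finsupp.smul_apply, Finsupp.mapRange_apply, smul_eq_mul]
      exact Nat.mul_div_cancel' (hdiv m hm i)
    rw [h1]
    exact hm

/-- A polynomial all of whose partial derivatives vanish has all exponents divisible by `p` (characteristic `p` field).
[folklore] -/
theorem forall_dvd_of_forall_pderiv_eq_zero {L σ : Type*} [Field L] (p : ℕ) [CharP L p]
    {h : MvPolynomial σ L} (hz : ∀ i, pderiv i h = 0) : ∀ m ∈ h.support, ∀ i, p ∣ m i := by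
  classical
  intro m hm i
  by_contra hnd
  have hmi : 1 ≤ m i := Nat.one_le_iff_ne_zero.2 fun h0 => hnd (h0 ▸ dvd_zero p)
  have e : m = (m - Finsupp.single i 1) + Finsupp.single i 1 := by
    ext j
    simp only [Finsupp.coe_add, Finsupp.coe_tsub, Pi.add_apply, Pi.sub_apply, Finsupp.single_apply]
    split_ifs with hij
    · subst hij; omega
    · omega
  have hc := coeff_pderiv (i := i) h (m - Finsupp.single i 1)
  rw [hz i, coeff_zero, ← e] at hc
  rcases mul_eq_zero.mp hc.symm with h' | h'
  · exact (MvPolynomial.mem_support_iff.mp hm) h'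
  · have hval : (m - Finsupp.single i 1 : σ →₀ ℕ) i + 1 = m i := by
      rw [Finsupp.tsub_apply, Finsupp.single_eq_same]
      omega
    have hcast : ((m i : ℕ) : L) = 0 := by
      rw [← hval, Nat.cast_succ]
      exact h'
    exact hnd ((CharP.cast_eq_zero_iff L p (m i)).1 hcast)


/-- Degree of an exponent occurring in a homogeneous polynomial. [folklore] -/
theorem degree_eq_of_mem_support_of_isHomogeneous {R σ : Type*} [CommSemiring R] {F : MvPolynomial σ R} {d : ℕ}
    (hF : F.IsHomogeneous d) {m : σ →₀ ℕ} (hm : m ∈ F.support) : m.degree = d := by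
  have h := hF (MvPolynomial.mem_support_iff.mp hm)
  rw [Finsupp.degree_eq_weight_one]
  exact h

/-- **(B3-core) Binary form modulo squares.** In characteristic `2` over a perfect field: if `F` is homogeneous of EVEN degree
`d` and every partial derivative `∂_i F` is free of the variable `w`, then `F = A + H²` with `A` free of `w` (and homogeneous of
degree `d`), `H` homogeneous of degree `d/2`. (Split `F = A + B` along «`w` occurs»; every exponent of every monomial of `B`
is even — for `i ≠ w` because `∂_i F` has no `w`, for `w` itself by the same reason when the `w`-exponent is `≥ 2` and by the
PARITY of `d` when it is `1` — so `B` is a square.) [folklore] -/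
theorem exists_add_sq_of_forall_pderiv_free {κ σ : Type*} [Field κ] [CharP κ 2] [PerfectRing κ 2]
    (w : σ) {F : MvPolynomial σ κ} {d : ℕ} (hF : F.IsHomogeneous d) (hd : Even d)
    (h : ∀ i, ∀ m ∈ (pderiv i F).support, m w = 0) :
    ∃ A H : MvPolynomial σ κ, (∀ m ∈ A.support, m w = 0) ∧ A.IsHomogeneous d ∧ H.IsHomogeneous (d / 2) ∧
      F = A + H ^ 2 := by
  classical
  haveI : Fact (Nat.Prime 2) := ⟨Nat.prime_two⟩
  -- split `F = A + B` along «`w` occurs»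
  set A : MvPolynomial σ κ := ∑ m ∈ F.support with m w = 0, monomial m (coeff m F) with hA
  set B : MvPolynomial σ κ := ∑ m ∈ F.support with ¬ m w = 0, monomial m (coeff m F) with hB
  have hAB : F = A + B := by
    conv_lhs => rw [← support_sum_monomial_coeff F]
    rw [hA, hB, Finset.sum_filter_add_sum_filter_not]
  have hcoeffA : ∀ n, coeff n A = if n w = 0 then coeff n F else 0 := by
    intro n
    rw [hA, coeff_sum]
    simp_rw [coeff_monomial]
    rw [Finset.sum_ite_eq']
    simp only [Finset.mem_filter, MvPolynomial.mem_support_iff, ne_eq]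
    by_cases hn : coeff n F = 0
    · simp [hn]
    · simp [hn]
  have hcoeffB : ∀ n, coeff n B = if n w = 0 then 0 else coeff n F := by
    intro n
    rw [hB, coeff_sum]
    simp_rw [coeff_monomial]
    rw [Finset.sum_ite_eq']
    simp only [Finset.mem_filter, MvPolynomial.mem_support_iff, ne_eq]
    by_cases hn : coeff n F = 0
    · simp [hn]
    · by_cases hnw : n w = 0 <;> simp [hn, hnw]
  have hsuppA : ∀ m ∈ A.support, m w = 0 ∧ m ∈ F.support := by
    intro m hm
    rw [MvPolynomial.mem_support_iff, hcoeffA] at hm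
    by_cases hmw : m w = 0
    · rw [if_pos hmw] at hm
      exact ⟨hmw, MvPolynomial.mem_support_iff.mpr hm⟩
    · rw [if_neg hmw] at hm
      exact (hm rfl).elim
  have hsuppB : ∀ m ∈ B.support, m w ≠ 0 ∧ m ∈ F.support := by
    intro m hm
    rw [MvPolynomial.mem_support_iff, hcoeffB] at hm
    by_cases hmw : m w = 0
    · rw [if_pos hmw] at hm
      exact (hm rfl).elim
    · rw [if_neg hmw] at hm
      exact ⟨hmw, MvPolynomial.mem_support_iff.mpr hm⟩
  -- the derivative test: an ODD exponent `m i` of a monomial `m` of `F` puts `m - e_i` into the support of `∂_i F`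
  have htest : ∀ i, ∀ m ∈ F.support, ¬ 2 ∣ m i → (m - Finsupp.single i 1) ∈ (pderiv i F).support := by
    intro i m hm hodd
    have hmi : 1 ≤ m i := Nat.one_le_iff_ne_zero.2 fun h0 => hodd (h0 ▸ dvd_zero 2)
    have e : m = (m - Finsupp.single i 1) + Finsupp.single i 1 := by
      ext j
      simp only [Finsupp.coe_add, Finsupp.coe_tsub, Pi.add_apply, Pi.sub_apply, Finsupp.single_apply]
      split_ifs with hij
      · subst hij; omega
      · omega
    rw [MvPolynomial.mem_support_iff, coeff_pderiv, ← e]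
    have hval : ((m - Finsupp.single i 1 : σ →₀ ℕ) i : κ) + 1 = (m i : κ) := by
      rw [← Nat.cast_succ, Finsupp.tsub_apply, Finsupp.single_eq_same]
      congr 1
      omega
    rw [hval]
    refine mul_ne_zero (MvPolynomial.mem_support_iff.mp hm) fun hcast => hodd ?_
    exact (CharP.cast_eq_zero_iff κ 2 (m i)).1 hcast
  -- every exponent of every monomial of `B` is even
  have heven : ∀ m ∈ B.support, ∀ i, 2 ∣ m i := by
    intro m hmB i
    obtain ⟨hmw, hmF⟩ := hsuppB m hmB
    by_contra hodd
    by_cases hiw : i = w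
    · subst hiw
      -- `m i` odd: either `≥ 3` (then `∂_i F ∋ m - e_i` with `i`-exponent `≥ 2`), or `= 1` (parity of `d`)
      by_cases h1 : m i = 1
      · -- all other exponents are even (by the case `i ≠ w` below, inlined), so `d = 1 + even` is odd
        have hothers : ∀ j, j ≠ i → 2 ∣ m j := by
          intro j hj
          by_contra hoddj
          have hmem := htest j m hmF hoddj
          have := h j _ hmem
          rw [Finsupp.tsub_apply, Finsupp.single_eq_of_ne' hj] at this
          omega
        have hdeg : m.degree = d := degree_eq_of_mem_support_of_isHomogeneous hF hmF
        rw [Finsupp.degree_apply] at hdeg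
        have hsplit : ∑ j ∈ m.support, m j = m i + ∑ j ∈ m.support.erase i, m j := by
          rw [← Finset.add_sum_erase m.support (fun j => m j) (Finsupp.mem_support_iff.mpr (by omega))]
        have hevensum : Even (∑ j ∈ m.support.erase i, m j) := by
          refine Finset.even_sum _ fun j hj => ?_
          exact even_iff_two_dvd.mpr (hothers j (Finset.ne_of_mem_erase hj))
        rw [hsplit, h1] at hdeg
        rw [← hdeg] at hd
        obtain ⟨r, hr⟩ := hevensum
        obtain ⟨s, hs⟩ := hd
        omega
      · have hmem := htest i m hmF hodd
        have := h i _ hmem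
        rw [Finsupp.tsub_apply, Finsupp.single_eq_same] at this
        omega
    · have hmem := htest i m hmF hodd
      have := h i _ hmem
      rw [Finsupp.tsub_apply, Finsupp.single_eq_of_ne' hiw] at this
      exact hmw (by omega)
  -- so `B = H²`
  obtain ⟨H, hH, hHsupp⟩ := exists_pow_eq_of_forall_dvd 2 heven
  refine ⟨A, H, fun m hm => (hsuppA m hm).1, ?_, ?_, by rw [hAB, hH]⟩
  · -- `A` homogeneous of degree `d`
    intro m hm
    have hmF := (hsuppA m (MvPolynomial.mem_support_iff.mpr hm)).2
    have := degree_eq_of_mem_support_of_isHomogeneous hF hmF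
    rw [Finsupp.degree_eq_weight_one] at this
    exact this
  · -- `H` homogeneous of degree `d / 2`
    intro n hn
    have hnB := hHsupp n (MvPolynomial.mem_support_iff.mpr hn)
    have hdeg := degree_eq_of_mem_support_of_isHomogeneous hF (hsuppB _ hnB).2
    rw [map_nsmul, smul_eq_mul] at hdeg
    have : n.degree = d / 2 := by omega
    rw [Finsupp.degree_eq_weight_one] at this
    exact this


/-- **Euler in characteristic 2, even degree.** For `A` homogeneous of even degree `d` in characteristic `2`:
`∑ i, X i * ∂_i A = d • A = 0`; if moreover `A` is free of the variable `w`, the sum runs over `i ≠ w` — for three variables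
`U, V, W` and `w = W` this is `U ∂_U A = V ∂_V A` (the relation behind strat-2's Euler factor `G`). [folklore] -/
theorem sum_X_mul_pderiv_eq_zero {κ σ : Type*} [Field κ] [CharP κ 2] [Fintype σ] {A : MvPolynomial σ κ} {d : ℕ}
    (hA : A.IsHomogeneous d) (hd : Even d) : ∑ i, X i * pderiv i A = 0 := by
  rw [hA.sum_X_mul_pderiv]
  obtain ⟨r, rfl⟩ := hd
  rw [add_nsmul, ← two_nsmul, smul_smul, nsmul_eq_mul, Nat.cast_mul, CharP.cast_eq_zero (MvPolynomial σ κ) 2, zero_mul,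
    zero_mul]

/-- Three variables, `A` free of `X 2`: `X 0 * ∂_0 A = X 1 * ∂_1 A` in characteristic `2` when `A` is homogeneous of even degree.
[folklore] -/
theorem X_mul_pderiv_eq_of_free {κ : Type*} [Field κ] [CharP κ 2] {A : MvPolynomial (Fin 3) κ} {d : ℕ}
    (hA : A.IsHomogeneous d) (hd : Even d) (hfree : ∀ m ∈ A.support, m 2 = 0) :
    X 0 * pderiv 0 A = X 1 * pderiv 1 A := by
  classical
  have h2 : pderiv 2 A = 0 := by
    refine pderiv_eq_zero_of_notMem_vars fun hmem => ?_
    obtain ⟨m, hm, hm2⟩ := (mem_vars_iff_mem_support 2).mp hmem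
    exact (Finsupp.mem_support_iff.mp hm2) (hfree m hm)
  have h := sum_X_mul_pderiv_eq_zero hA hd
  rw [Fin.sum_univ_three, h2, mul_zero, add_zero] at h
  -- `a + b = 0` in characteristic 2 means `a = b`
  have h' := eq_neg_of_add_eq_zero_left h
  rw [h']
  -- `-b = b` in characteristic 2
  haveI : CharP (MvPolynomial (Fin 3) κ) 2 := inferInstance
  exact (CharTwo.neg_eq (X 1 * pderiv 1 A))


/-- **Euler factor (strat-2 (B3)).** For `A ∈ κ[X₀, X₁, X₂]` homogeneous of even degree, free of `X 2`, characteristic `2`: there is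
ONE `G` with `∂₀ A = X 1 · G` and `∂₁ A = X 0 · G` (from `X 0 · ∂₀ A = X 1 · ∂₁ A` and primality of `X 0`). [folklore] -/
theorem exists_euler_factor {κ : Type*} [Field κ] [CharP κ 2] {A : MvPolynomial (Fin 3) κ} {d : ℕ}
    (hA : A.IsHomogeneous d) (hd : Even d) (hfree : ∀ m ∈ A.support, m 2 = 0) :
    ∃ G : MvPolynomial (Fin 3) κ, pderiv 0 A = X 1 * G ∧ pderiv 1 A = X 0 * G := by
  have h := X_mul_pderiv_eq_of_free hA hd hfree
  have hdvd : (X 0 : MvPolynomial (Fin 3) κ) ∣ X 1 * pderiv 1 A := ⟨pderiv 0 A, h.symm⟩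
  rcases X_dvd_mul_iff.mp hdvd with h01 | ⟨G, hG⟩
  · exact absurd (X_dvd_X.mp h01) (by decide)
  · refine ⟨G, ?_, hG⟩
    have h' : (X 0 : MvPolynomial (Fin 3) κ) * pderiv 0 A = X 0 * (X 1 * G) := by
      rw [h, hG]; ring
    exact mul_left_cancel₀ (X_ne_zero 0) h'

end Summit.ResolutionOfSingularities.ResolutionOfSingularities.Theorems.SwitchingDichotomy.ConstOrder

end
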